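import Literature.NumberTheory.EllipticCurves.ModularSymbolsParabolicCohomologyProofs
import Literature.GroupTheory.SpecificGroups.ModularGroupFreeProduct
import HarnessLib

/-!
# `dim_K H¹_P(Γ₀(N), K) ≤ 2 dim_ℂ S₂(Γ₀(N))` over every field `K` with `6 ≠ 0`
# (Shimura's count mod `p`, through `PSL₂(ℤ) = ℤ/2 ∗ ℤ/3` and Shapiro's lemma)

Topic `Literature/NumberTheory/ModularForms`; namespace `Literature.NumberTheory.ModularForms`
(grouping sub-namespace `ParabolicCountK`).  Everything here is PROVED; no named facts.

For a field `K` let `H¹_P(Γ₀(N), K)` be the `K`-vector space of **parabolic cocycles with trivial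
coefficients**: maps `u : Γ₀(N) → K` with `u(γδ) = u(γ) + u(δ)` vanishing on the parabolic
elements (`parabolicHoms K N`; Shimura 1971, §8.1, (8.1.1), (8.1.4) with `n = 0`).  The tree proves
`dim_ℝ H¹_P(Γ₀(N), ℝ) = 2 dim_ℂ S₂(Γ₀(N))` (`finrank_parabolicCocycles_eq_holds`,
`ModularSymbolsParabolicCohomologyProofs`), the upper bound by an Euler-characteristic count with
*real traces* (the rank of a projection is its trace), which does not transfer to positive
characteristic.  Here we prove the upper bound

* `ParabolicCountK.finrank_parabolicHoms_le` : **`dim_K H¹_P(Γ₀(N), K) ≤ 2 dim_ℂ S₂(Γ₀(N))`**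
  for every field `K` in which `2 ≠ 0` and `3 ≠ 0` and every `N ≥ 1`

— the statement needed for coefficients `K = 𝔽_p`, `p ≥ 5` (reductions mod `p` of Eisenstein
classes; Mazur 1977, II.5–II.9) — by a characteristic-free route:

1. **Shapiro.** `u ↦ F_u`, `F_u(g)(x) = u(s(x)⁻¹ g s(g⁻¹x))` (`s` a section of
   `SL(2, ℤ) → X = SL(2, ℤ)/Γ₀(N)`) is an injective linear map from `H¹_P(Γ₀(N), K)` to the
   crossed homomorphisms `Z¹ = Z¹(SL(2, ℤ), K^X)` of the permutation representation
   `(ρ(g)f)(x) = f(g⁻¹x)` (`liftL`, `liftHom_injective`), whose image meets the coboundaries `B¹`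
   trivially (`range_liftHom_inf_range_cobd`: evaluate at the identity coset) and is killed,
   like `B¹`, by the **cusp sums of `F(T)`** (`cuspMap`; for `F_u`:
   `∑_{orbit} F_u(T) = F_u(T^w)(·) = u(s⁻¹T^w s) = 0`, a parabolic element).
2. **Counting with the free product** (`ModularGroupFreeProduct`): `dim Z¹ = 2μ - dim W^S - dim W^U`
   and `dim B¹ = μ - 1` (`W = K^X`, `μ = [SL(2, ℤ) : Γ₀(N)]`, `U = ST`), and the cusp sums take at
   least `ε_∞ - 1` independent values on `Z¹` (`F(T) = ρ(S)⁻¹(w_U - w_S)` sweeps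
   `(ρS - 1)W + (ρU - 1)W = ker(Σ)`, by transitivity), so
   `dim H¹_P ≤ μ + 2 - dim W^S - dim W^U - ε_∞`.
3. **Field independence of the orbit counts**: `dim_K W^g = #⟨g⟩\X = dim_ℝ ℝ^X)^g` (functions on
   the orbit space, `finrank_fixedFun_eq_card`), and over `ℝ` the tree's trace computation gives
   `2 dim W^S = μ + ε₂`, `3 dim W^U = μ + 2ε₃`; with the genus formula
   `12 dim S₂ + 3ε₂ + 4ε₃ + 6ε_∞ = 12 + μ` (`twelve_mul_finrank_cuspForm_two_gamma0_holds`) this is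
   `6 dim_K H¹_P ≤ 12 dim_ℂ S₂`.

## References

* G. Shimura, *Introduction to the arithmetic theory of automorphic functions*, 1971, §8.1
  ((8.1.1)–(8.1.4), Prop. 8.1), §8.2 ((8.2.23)–(8.2.24)). [ShimuraIATAF1971]
* J.-P. Serre, *Trees*, 1980, I.4.2, II.2.8. [SerreTrees1980]
* K. S. Brown, *Cohomology of groups*, GTM 87, III.6 (Shapiro), VII.9. [Brown1982]
* B. Mazur, *Modular curves and the Eisenstein ideal*, Publ. Math. IHÉS 47 (1977), II.5–II.9.
  [Mazur1977]
-/

noncomputable section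

open scoped MatrixGroups
open CongruenceSubgroup Matrix.SpecialLinearGroup ModularGroup Module
open Literature.NumberTheory.EllipticCurves.ModularForms
open Literature.GroupTheory.SpecificGroups.ModularGroupFreeProduct

namespace Literature.NumberTheory.ModularForms

namespace ParabolicCountK

open scoped Classical

variable (K : Type*) [Field K] (N : ℕ)

/-! ### Parabolic cocycles with coefficients in `K` -/

/-- **`H¹_P(Γ₀(N), K)`**: the maps `u : Γ₀(N) → K` with `u(γδ) = u(γ) + u(δ)` and `u(π) = 0`
for every parabolic `π ∈ Γ₀(N)` (Shimura's parabolic cocycles for the trivial module `K`; the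
coboundaries vanish). [cite: ShimuraIATAF1971, §8.1 (8.1.1), (8.1.4)] -/
def parabolicHoms : Submodule K (Gamma0 N → K) where
  carrier := {u | (∀ γ δ : Gamma0 N, u (γ * δ) = u γ + u δ) ∧
    ∀ γ : Gamma0 N, ((γ : SL(2, ℤ)) : Matrix (Fin 2) (Fin 2) ℤ).IsParabolic → u γ = 0}
  add_mem' := by
    rintro u v ⟨hu, hu'⟩ ⟨hv, hv'⟩
    refine ⟨fun γ δ ↦ ?_, fun γ hγ ↦ ?_⟩
    · simp only [Pi.add_apply, hu, hv]; abel
    · simp [hu' γ hγ, hv' γ hγ]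
  zero_mem' := ⟨fun _ _ ↦ by simp, fun _ _ ↦ rfl⟩
  smul_mem' := by
    rintro c u ⟨hu, hu'⟩
    refine ⟨fun γ δ ↦ ?_, fun γ hγ ↦ ?_⟩
    · simp only [Pi.smul_apply, hu, smul_eq_mul]; ring
    · simp [hu' γ hγ]

variable {K N}

/-- Unfolding `parabolicHoms`. [folklore] -/
theorem mem_parabolicHoms_iff {u : Gamma0 N → K} :
    u ∈ parabolicHoms K N ↔ (∀ γ δ : Gamma0 N, u (γ * δ) = u γ + u δ) ∧
      ∀ γ : Gamma0 N, ((γ : SL(2, ℤ)) : Matrix (Fin 2) (Fin 2) ℤ).IsParabolic → u γ = 0 :=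
  Iff.rfl

/-- `u(1) = 0` for an additive `u`. [folklore] -/
theorem map_one_of_additive {u : Gamma0 N → K} (hu : ∀ γ δ, u (γ * δ) = u γ + u δ) : u 1 = 0 := by
  have h := hu 1 1
  rw [mul_one] at h
  simpa using h

/-- `u(γ⁻¹) = -u(γ)` for an additive `u`. [folklore] -/
theorem map_inv_of_additive {u : Gamma0 N → K} (hu : ∀ γ δ, u (γ * δ) = u γ + u δ) (γ : Gamma0 N) :
    u γ⁻¹ = -u γ := by
  have h := hu γ⁻¹ γ
  rw [inv_mul_cancel, map_one_of_additive hu] at h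
  exact eq_neg_of_add_eq_zero_left h.symm

/-- An additive `u` is a class function. [folklore] -/
theorem map_conj_of_additive {u : Gamma0 N → K} (hu : ∀ γ δ, u (γ * δ) = u γ + u δ) (a γ : Gamma0 N) :
    u (a⁻¹ * γ * a) = u γ := by
  rw [hu, hu, map_inv_of_additive hu]; ring

/-! ### The permutation representation `K^X`, `X = SL(2, ℤ)/Γ₀(N)` -/

variable (K N) in
/-- The **permutation representation** of `SL(2, ℤ)` on `K^X`, `X = SL(2, ℤ)/Γ₀(N)`:
`(ρ(g)f)(x) = f(g⁻¹x)`. [folklore] -/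
def permRep : Representation K SL(2, ℤ) (Gamma0Coset N → K) where
  toFun g := LinearMap.funLeft K K fun x ↦ g⁻¹ • x
  map_one' := by ext f x; simp
  map_mul' g h := by ext f x; simp [mul_smul]

/-- Unfolding `permRep`. [folklore] -/
@[simp] theorem permRep_apply (g : SL(2, ℤ)) (f : Gamma0Coset N → K) (x : Gamma0Coset N) :
    permRep K N g f x = f (g⁻¹ • x) := rfl

/-- `-1` acts trivially on `K^X` (`-1 ∈ Γ₀(N)` is central). [folklore] -/
theorem permRep_neg_one : permRep K N (-1) = 1 := by
  ext f x
  rw [permRep_apply, show (-1 : SL(2, ℤ))⁻¹ = -1 by simp, neg_one_smul_coset]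
  rfl

/-! ### Invariant functions -/

variable (K) in
/-- The functions on `X` invariant under `g`. [folklore] -/
def fixedFun (g : SL(2, ℤ)) : Submodule K (Gamma0Coset N → K) where
  carrier := {f | ∀ x, f (g • x) = f x}
  add_mem' hf hg x := by simp [hf x, hg x]
  zero_mem' _ := rfl
  smul_mem' c f hf x := by simp [hf x]

/-- Membership in `fixedFun`. [folklore] -/
theorem mem_fixedFun_iff {g : SL(2, ℤ)} {f : Gamma0Coset N → K} :
    f ∈ fixedFun K g ↔ ∀ x, f (g • x) = f x := Iff.rfl

/-- `fixedFun g = ker(ρ(g) - 1)`. [folklore] -/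
theorem fixedFun_eq_ker (g : SL(2, ℤ)) : fixedFun K g = LinearMap.ker (permRep K N g - 1) := by
  ext f
  simp only [mem_fixedFun_iff, LinearMap.mem_ker, LinearMap.sub_apply, Module.End.one_apply,
    sub_eq_zero]
  constructor
  · intro h
    funext x
    rw [permRep_apply, ← h (g⁻¹ • x), smul_inv_smul]
  · intro h x
    have := congrFun h (g • x)
    rw [permRep_apply, inv_smul_smul] at this
    exact this.symm

/-- An invariant function is invariant under all integer powers. [folklore] -/
theorem apply_zpow_smul_of_mem_fixedFun {g : SL(2, ℤ)} {f : Gamma0Coset N → K}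
    (hf : f ∈ fixedFun K g) (n : ℤ) (x : Gamma0Coset N) : f (g ^ n • x) = f x := by
  induction n using Int.induction_on generalizing x with
  | zero => rw [zpow_zero, one_smul]
  | succ n ih => rw [zpow_add, zpow_one, mul_smul, ih]; exact hf x
  | pred n ih =>
    rw [zpow_sub, zpow_one, mul_smul, ih]
    have := hf (g⁻¹ • x)
    rw [smul_inv_smul] at this
    exact this.symm

/-- The orbit space of `⟨g⟩` on `X`. [folklore] -/
abbrev OrbSp (N : ℕ) (g : SL(2, ℤ)) : Type :=
  MulAction.orbitRel.Quotient (Subgroup.zpowers g) (Gamma0Coset N)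

/-- Pulling back functions on the orbit space gives the invariant functions. [folklore] -/
def pullback (g : SL(2, ℤ)) : (OrbSp N g → K) →ₗ[K] (Gamma0Coset N → K) :=
  LinearMap.funLeft K K (Quotient.mk'' : Gamma0Coset N → OrbSp N g)

/-- The pullback is injective. [folklore] -/
theorem pullback_injective (g : SL(2, ℤ)) : Function.Injective (pullback (K := K) (N := N) g) :=
  LinearMap.funLeft_injective_of_surjective K K _ Quotient.mk''_surjective

/-- The image of the pullback is `fixedFun g`. [folklore] -/
theorem range_pullback (g : SL(2, ℤ)) :
    LinearMap.range (pullback (K := K) g) = fixedFun K (N := N) g := by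
  ext f
  simp only [LinearMap.mem_range, mem_fixedFun_iff]
  constructor
  · rintro ⟨h, rfl⟩ x
    change h (Quotient.mk'' (g • x)) = h (Quotient.mk'' x)
    congr 1
    apply Quotient.sound'
    rw [MulAction.orbitRel_apply]
    exact ⟨⟨g, Subgroup.mem_zpowers g⟩, rfl⟩
  · intro hf
    refine ⟨Quotient.lift f ?_, ?_⟩
    · intro x y hxy
      change (MulAction.orbitRel (Subgroup.zpowers g) (Gamma0Coset N)) x y at hxy
      rw [MulAction.orbitRel_apply] at hxy
      obtain ⟨⟨k, hk⟩, rfl⟩ := hxy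
      obtain ⟨n, rfl⟩ := Subgroup.mem_zpowers_iff.mp hk
      exact apply_zpow_smul_of_mem_fixedFun hf n y
    · rfl

/-- Over `ℝ`: `fixedFun ℝ S = range(1 + S^*)` (`S^*` is an involution). [folklore] -/
theorem fixedFun_real_S_eq : fixedFun ℝ (N := N) S = LinearMap.range (ParabolicCount.relS N) := by
  ext f
  simp only [mem_fixedFun_iff, LinearMap.mem_range]
  constructor
  · intro hf
    refine ⟨(2 : ℝ)⁻¹ • f, ?_⟩
    funext x
    simp only [ParabolicCount.relS, LinearMap.add_apply, LinearMap.id_apply, map_smul,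
      Pi.add_apply, Pi.smul_apply, ParabolicCount.coperm_apply, smul_eq_mul, hf x]
    ring
  · rintro ⟨b, rfl⟩ x
    simp only [ParabolicCount.relS, LinearMap.add_apply, LinearMap.id_apply, Pi.add_apply,
      ParabolicCount.coperm_apply, smul_smul, S_mul_S_eq_neg_one, neg_one_smul_coset]
    rw [add_comm]

/-- Over `ℝ`: `fixedFun ℝ U = range(1 + U^* + U^{*2})` (`U^{*3} = 1`). [folklore] -/
theorem fixedFun_real_U_eq : fixedFun ℝ (N := N) U = LinearMap.range (ParabolicCount.relST N) := by
  have hU3 : ∀ x : Gamma0Coset N, (S * T) • (S * T) • (S * T) • x = x := fun x ↦ by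
    rw [← mul_smul, ← mul_smul, ParabolicCount.ST_pow_three_eq, neg_one_smul_coset]
  ext f
  simp only [mem_fixedFun_iff, LinearMap.mem_range]
  constructor
  · intro hf
    refine ⟨(3 : ℝ)⁻¹ • f, ?_⟩
    funext x
    have h1 : f ((S * T) • x) = f x := hf x
    have h2 : f ((S * T) • (S * T) • x) = f x := by rw [show S * T = U from rfl, hf, hf]
    simp only [ParabolicCount.relST, LinearMap.add_apply, LinearMap.id_apply, LinearMap.comp_apply,
      map_smul, Pi.add_apply, Pi.smul_apply, ParabolicCount.coperm_apply, smul_eq_mul]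
    rw [h1, h2]
    ring
  · rintro ⟨b, rfl⟩ x
    simp only [ParabolicCount.relST, LinearMap.add_apply, LinearMap.id_apply, LinearMap.comp_apply,
      Pi.add_apply, ParabolicCount.coperm_apply, U_def]
    rw [hU3]
    abel

/-- A function invariant under `S` and `U` is constant (`⟨S, U⟩ = SL(2, ℤ)` is transitive on `X`).
[folklore] -/
theorem const_of_mem_fixedFun_S_U {f : Gamma0Coset N → K} (hS : f ∈ fixedFun K S)
    (hU : f ∈ fixedFun K U) (x : Gamma0Coset N) : f x = f ((1 : SL(2, ℤ)) : Gamma0Coset N) := by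
  induction x using QuotientGroup.induction_on with
  | H g =>
    have hg : g ∈ Subgroup.closure ({S, U} : Set SL(2, ℤ)) := by
      rw [closure_S_U]; exact Subgroup.mem_top g
    suffices h : ∀ y : Gamma0Coset N, f (g • y) = f y by
      have := h ((1 : SL(2, ℤ)) : Gamma0Coset N)
      rwa [MulAction.Quotient.smul_mk, smul_eq_mul, mul_one] at this
    induction hg using Subgroup.closure_induction with
    | mem z hz =>
      rcases hz with rfl | rfl
      · exact hS
      · exact hU
    | one => intro y; rw [one_smul]
    | mul a b _ _ ha hb => intro y; rw [mul_smul, ha, hb]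
    | inv a _ ha => intro y; rw [← ha (a⁻¹ • y), smul_inv_smul]

/-- **`W^S ∩ W^U` is the line of constants**: `dim = 1`. [folklore] -/
theorem finrank_fixedFun_S_inf_U :
    Module.finrank K ↥(fixedFun K (N := N) S ⊓ fixedFun K U) = 1 := by
  have h : fixedFun K (N := N) S ⊓ fixedFun K U = K ∙ (fun _ ↦ (1 : K)) := by
    ext f
    simp only [Submodule.mem_inf, Submodule.mem_span_singleton]
    constructor
    · rintro ⟨hS, hU⟩
      refine ⟨f ((1 : SL(2, ℤ)) : Gamma0Coset N), ?_⟩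
      funext x
      rw [Pi.smul_apply, smul_eq_mul, mul_one, const_of_mem_fixedFun_S_U hS hU x]
    · rintro ⟨c, rfl⟩
      exact ⟨fun x ↦ rfl, fun x ↦ rfl⟩
  rw [h, finrank_span_singleton]
  exact fun h0 ↦ one_ne_zero (congrFun h0 ((1 : SL(2, ℤ)) : Gamma0Coset N))

/-! ### The Shapiro lift (left convention) -/

/-- The transfer element `λ(g, x) = s(x)⁻¹ g s(g⁻¹x) ∈ Γ₀(N)` (the inverse of the tree's
`liftElem g⁻¹ x`). [cite: Brown1982, III.6] -/
def lam (g : SL(2, ℤ)) (x : Gamma0Coset N) : Gamma0 N := (ParabolicCount.liftElem g⁻¹ x)⁻¹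

/-- Unfolding `lam`. [folklore] -/
theorem coe_lam (g : SL(2, ℤ)) (x : Gamma0Coset N) :
    (lam g x : SL(2, ℤ)) = (ParabolicCount.sec x)⁻¹ * g * ParabolicCount.sec (g⁻¹ • x) := by
  rw [lam, Subgroup.coe_inv, ParabolicCount.coe_liftElem]
  group

/-- The cocycle identity `λ(gh, x) = λ(g, x) λ(h, g⁻¹x)`. [cite: Brown1982, III.6] -/
theorem lam_mul (g h : SL(2, ℤ)) (x : Gamma0Coset N) : lam (g * h) x = lam g x * lam h (g⁻¹ • x) := by
  rw [lam, lam, lam, mul_inv_rev, ParabolicCount.liftElem_mul, mul_inv_rev]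

/-- `λ(1, x) = 1`. [folklore] -/
theorem lam_one (x : Gamma0Coset N) : lam (N := N) 1 x = 1 := by
  rw [lam, inv_one, ParabolicCount.liftElem_one, inv_one]

/-- `λ(γ, Γ₀(N)) = s₀⁻¹ γ s₀` for `γ ∈ Γ₀(N)`, `s₀ = s(Γ₀(N)) ∈ Γ₀(N)`. [folklore] -/
theorem lam_coe_one (γ : Gamma0 N) : lam (γ : SL(2, ℤ)) ((1 : SL(2, ℤ)) : Gamma0Coset N) =
    (⟨ParabolicCount.sec ((1 : SL(2, ℤ)) : Gamma0Coset N), ParabolicCount.sec_one_mem⟩ : Gamma0 N)⁻¹ *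
      γ * ⟨ParabolicCount.sec ((1 : SL(2, ℤ)) : Gamma0Coset N), ParabolicCount.sec_one_mem⟩ := by
  apply Subtype.ext
  rw [coe_lam, ParabolicCount.smul_coe_one_of_mem (inv_mem γ.2)]
  rfl

/-- The **Shapiro lift** `F_u(g)(x) = u(λ(g, x))`. [cite: Brown1982, III.6 Prop. 6.2] -/
def liftL (u : Gamma0 N → K) (g : SL(2, ℤ)) : Gamma0Coset N → K := fun x ↦ u (lam g x)

omit [Field K] in
/-- Unfolding `liftL`. [folklore] -/
@[simp] theorem liftL_apply (u : Gamma0 N → K) (g : SL(2, ℤ)) (x : Gamma0Coset N) :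
    liftL u g x = u (lam g x) := rfl

/-- **The Shapiro lift of an additive map is a crossed homomorphism** for `ρ`. [cite: Brown1982, III.6] -/
theorem isCrossedHom_liftL {u : Gamma0 N → K} (hu : ∀ γ δ, u (γ * δ) = u γ + u δ) :
    IsCrossedHom (permRep K N) (liftL u) := by
  intro g h
  funext x
  simp only [liftL_apply, Pi.add_apply, permRep_apply, lam_mul, hu]

/-- **The lift restricts to `u`**: `F_u(γ)(Γ₀(N)) = u(γ)`. [folklore] -/
theorem liftL_apply_coe_one {u : Gamma0 N → K} (hu : ∀ γ δ, u (γ * δ) = u γ + u δ) (γ : Gamma0 N) :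
    liftL u γ ((1 : SL(2, ℤ)) : Gamma0Coset N) = u γ := by
  rw [liftL_apply, lam_coe_one, map_conj_of_additive hu]

/-- `F(gⁿ)(x) = ∑_{i<n} F(g)(g⁻ⁱx)` for a crossed homomorphism `F`. [folklore] -/
theorem apply_pow_of_isCrossedHom {F : SL(2, ℤ) → Gamma0Coset N → K}
    (hF : IsCrossedHom (permRep K N) F) (g : SL(2, ℤ)) (n : ℕ) (x : Gamma0Coset N) :
    F (g ^ n) x = ∑ i ∈ Finset.range n, F g ((g ^ i)⁻¹ • x) := by
  induction n generalizing x with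
  | zero => simp [hF.map_one]
  | succ n ih =>
    rw [pow_succ', hF, Pi.add_apply, permRep_apply, ih, Finset.sum_range_succ', pow_zero, inv_one,
      one_smul, add_comm]
    simp_rw [smul_smul, ← mul_inv_rev, ← pow_succ']

variable (K N) in
/-- The Shapiro lift as a linear map `H¹_P(Γ₀(N), K) → Z¹(SL(2, ℤ), K^X)`. [cite: Brown1982, III.6] -/
def liftHom : parabolicHoms K N →ₗ[K] crossedHoms (permRep K N) where
  toFun u := ⟨liftL (u : Gamma0 N → K), isCrossedHom_liftL (mem_parabolicHoms_iff.mp u.2).1⟩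
  map_add' u v := by ext g x; rfl
  map_smul' c u := by ext g x; rfl

/-- Unfolding `liftHom`. [folklore] -/
@[simp] theorem coe_liftHom_apply (u : parabolicHoms K N) :
    ((liftHom K N u : crossedHoms (permRep K N)) : SL(2, ℤ) → Gamma0Coset N → K) =
      liftL (u : Gamma0 N → K) := rfl

/-- **The lift is injective** (evaluate at the identity coset). [cite: Brown1982, III.6 Prop. 6.2] -/
theorem liftHom_injective : Function.Injective (liftHom K N) := by
  intro u v h
  apply Subtype.ext
  funext γ
  have h1 := congrArg (fun F : crossedHoms (permRep K N) ↦ F.1 γ ((1 : SL(2, ℤ)) : Gamma0Coset N)) h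
  simp only [coe_liftHom_apply] at h1
  rwa [liftL_apply_coe_one (mem_parabolicHoms_iff.mp u.2).1,
    liftL_apply_coe_one (mem_parabolicHoms_iff.mp v.2).1] at h1

/-- **The image of the lift meets the coboundaries trivially.** [cite: ShimuraIATAF1971, §8.1] -/
theorem range_liftHom_inf_range_cobd :
    LinearMap.range (liftHom K N) ⊓ LinearMap.range (cobd (permRep K N)) = ⊥ := by
  rw [eq_bot_iff]
  rintro F ⟨⟨u, rfl⟩, ⟨f, hf⟩⟩
  rw [Submodule.mem_bot]
  have hu0 : u = 0 := by
    apply Subtype.ext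
    funext γ
    have h1 := congrArg (fun F : crossedHoms (permRep K N) ↦ F.1 γ ((1 : SL(2, ℤ)) : Gamma0Coset N)) hf
    simp only [coe_liftHom_apply, cobd_apply, Pi.sub_apply, permRep_apply,
      ParabolicCount.smul_coe_one_of_mem (inv_mem γ.2), sub_self] at h1
    rw [liftL_apply_coe_one (mem_parabolicHoms_iff.mp u.2).1] at h1
    exact h1.symm
  rw [hu0, map_zero]

/-! ### `(ρS - 1)W + (ρU - 1)W` contains every `(ρg - 1)W` -/

variable (K N) in
/-- `R = (ρS - 1)W + (ρU - 1)W`. [folklore] -/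
def relSum : Submodule K (Gamma0Coset N → K) :=
  LinearMap.range (permRep K N S - 1) ⊔ LinearMap.range (permRep K N U - 1)

/-- `(ρ(g) - 1)W ⊆ R` for every `g ∈ SL(2, ℤ) = ⟨S, U⟩`
(`ρ(gh) - 1 = (ρg - 1)ρh + (ρh - 1)`). [folklore] -/
theorem range_sub_one_le_relSum (g : SL(2, ℤ)) : LinearMap.range (permRep K N g - 1) ≤ relSum K N := by
  let M : Subgroup SL(2, ℤ) :=
    { carrier := {g | LinearMap.range (permRep K N g - 1) ≤ relSum K N}
      mul_mem' := fun {a b} ha hb ↦ by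
        rintro _ ⟨v, rfl⟩
        have h : (permRep K N (a * b) - 1) v =
            (permRep K N a - 1) (permRep K N b v) + (permRep K N b - 1) v := by
          simp only [map_mul, LinearMap.sub_apply, Module.End.mul_apply, Module.End.one_apply]
          abel
        rw [h]
        exact add_mem (ha ⟨_, rfl⟩) (hb ⟨_, rfl⟩)
      one_mem' := by
        change LinearMap.range (permRep K N 1 - 1) ≤ relSum K N
        rw [map_one, sub_self, LinearMap.range_zero]
        exact bot_le
      inv_mem' := fun {a} ha ↦ by
        rintro _ ⟨v, rfl⟩
        have e : permRep K N a (permRep K N a⁻¹ v) = v := by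
          rw [← Module.End.mul_apply, ← map_mul, mul_inv_cancel, map_one, Module.End.one_apply]
        have h : (permRep K N a⁻¹ - 1) v = -((permRep K N a - 1) (permRep K N a⁻¹ v)) := by
          rw [LinearMap.sub_apply, LinearMap.sub_apply, e, Module.End.one_apply,
            Module.End.one_apply, neg_sub]
        rw [h]
        exact neg_mem (ha ⟨_, rfl⟩) }
  have hM : M = ⊤ := by
    rw [← top_le_iff, ← closure_S_U]
    refine (Subgroup.closure_le M).mpr ?_
    rintro z (rfl | rfl)
    · exact (le_sup_left : LinearMap.range (permRep K N S - 1) ≤ relSum K N)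
    · exact (le_sup_right : LinearMap.range (permRep K N U - 1) ≤ relSum K N)
  have : g ∈ M := hM ▸ Subgroup.mem_top g
  exact this

/-! ### Finite level: orbit counts, cusp sums and the count -/

section Finite

variable [NeZero N]

/-- The orbit space is finite. [folklore] -/
instance (g : SL(2, ℤ)) : Fintype (OrbSp N g) := Quotient.fintype _

/-- **`dim_K W^g = #⟨g⟩\X`** — independent of the field `K`. [folklore] -/
theorem finrank_fixedFun_eq_card (g : SL(2, ℤ)) :
    Module.finrank K (fixedFun K (N := N) g) = Fintype.card (OrbSp N g) := by
  rw [← range_pullback, LinearMap.finrank_range_of_inj (pullback_injective g),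
    Module.finrank_fintype_fun_eq_card]

/-- **`2 dim_K W^S = μ + ε₂`** for every field `K`. [cite: ShimuraIATAF1971, §1.5 Prop. 1.43, §8.1] -/
theorem two_mul_finrank_fixedFun_S :
    2 * Module.finrank K (fixedFun K (N := N) S) =
      Fintype.card (Gamma0Coset N) + (Finset.univ.filter fun q : Gamma0Coset N ↦ S • q = q).card := by
  rw [finrank_fixedFun_eq_card, ← finrank_fixedFun_eq_card (K := ℝ), fixedFun_real_S_eq]
  exact ParabolicCount.two_mul_finrank_range_relS

/-- **`3 dim_K W^U = μ + 2ε₃`** for every field `K`. [cite: ShimuraIATAF1971, §1.5 Prop. 1.43, §8.1] -/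
theorem three_mul_finrank_fixedFun_U :
    3 * Module.finrank K (fixedFun K (N := N) U) =
      Fintype.card (Gamma0Coset N) +
        2 * (Finset.univ.filter fun q : Gamma0Coset N ↦ (S * T) • q = q).card := by
  rw [finrank_fixedFun_eq_card, ← finrank_fixedFun_eq_card (K := ℝ), fixedFun_real_U_eq]
  exact ParabolicCount.three_mul_finrank_range_relST

/-! #### The augmentation kernel lies in `(ρS - 1)W + (ρU - 1)W` -/

variable (K N) in
/-- The augmentation `f ↦ ∑ₓ f(x)`. [folklore] -/
def aug : (Gamma0Coset N → K) →ₗ[K] K where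
  toFun f := ∑ x, f x
  map_add' f g := by simp [Finset.sum_add_distrib]
  map_smul' c f := by simp [Finset.mul_sum]

/-- Unfolding `aug`. [folklore] -/
@[simp] theorem aug_apply (f : Gamma0Coset N → K) : aug K N f = ∑ x, f x := rfl

/-- The augmentation is invariant. [folklore] -/
theorem aug_permRep (g : SL(2, ℤ)) (f : Gamma0Coset N → K) : aug K N (permRep K N g f) = aug K N f := by
  simp only [aug_apply, permRep_apply]
  exact Fintype.sum_equiv (MulAction.toPerm g⁻¹) _ _ fun x ↦ rfl

/-- **`ker(Σ) ⊆ (ρS - 1)W + (ρU - 1)W`** (transitivity of `SL(2, ℤ)` on `X`). [folklore] -/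
theorem ker_aug_le_relSum : LinearMap.ker (aug K N) ≤ relSum K N := by
  intro f hf
  rw [LinearMap.mem_ker, aug_apply] at hf
  have hdec : f = ∑ x, f x • (Pi.single x (1 : K) - Pi.single ((1 : SL(2, ℤ)) : Gamma0Coset N) 1) := by
    simp only [smul_sub, Finset.sum_sub_distrib, ← Finset.sum_smul, hf, zero_smul, sub_zero]
    funext y
    simp [Finset.sum_apply, Pi.single_apply]
  rw [hdec]
  refine Submodule.sum_mem _ fun x _ ↦ Submodule.smul_mem _ _ ?_
  induction x using QuotientGroup.induction_on with
  | H g =>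
    have h : Pi.single (g : Gamma0Coset N) (1 : K) - Pi.single ((1 : SL(2, ℤ)) : Gamma0Coset N) 1 =
        (permRep K N g - 1) (Pi.single ((1 : SL(2, ℤ)) : Gamma0Coset N) 1) := by
      funext y
      simp only [Pi.sub_apply, LinearMap.sub_apply, Module.End.one_apply, permRep_apply,
        Pi.single_apply, inv_smul_eq_iff, MulAction.Quotient.smul_mk, smul_eq_mul, mul_one]
    rw [h]
    exact range_sub_one_le_relSum g ⟨_, rfl⟩

/-! #### Cusp sums -/

variable (K N) in
/-- The **cusp-sum map** `K^X → K^{cusps}`, `f ↦ (∑_{y ∈ ⟨T⟩b} f(y))_b` over the base points `b`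
of the `⟨T⟩`-orbits. [folklore] -/
def cuspSumK : (Gamma0Coset N → K) →ₗ[K] ({x // x ∈ basePoints N} → K) where
  toFun f b := ∑ y ∈ orbitFin N b.1, f y
  map_add' f f' := by funext b; simp [Finset.sum_add_distrib]
  map_smul' c f := by funext b; simp [Finset.mul_sum]

/-- Unfolding `cuspSumK`. [folklore] -/
@[simp] theorem cuspSumK_apply (f : Gamma0Coset N → K) (b : {x // x ∈ basePoints N}) :
    cuspSumK K N f b = ∑ y ∈ orbitFin N b.1, f y := rfl

omit [Field K] in
/-- `T⁻¹ y` lies in the orbit finset of `y`. [folklore] -/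
theorem T_inv_smul_mem_orbitFin {b y : Gamma0Coset N} (hy : y ∈ orbitFin N b) :
    T⁻¹ • y ∈ orbitFin N b := by
  obtain ⟨i, rfl⟩ := (mem_orbitFin' N).mp hy
  rw [mem_orbitFin']
  refine ⟨i + (width N b - 1), ?_⟩
  have hw : i + (width N b - 1) + 1 = i + width N b := by have := width_pos N b; omega
  rw [eq_inv_smul_iff, smul_smul, ← pow_succ', hw, pow_add, mul_smul, T_pow_width_smul]

omit [Field K] in
/-- `T y` lies in the orbit finset of `y`. [folklore] -/
theorem T_smul_mem_orbitFin {b y : Gamma0Coset N} (hy : y ∈ orbitFin N b) : T • y ∈ orbitFin N b := by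
  obtain ⟨i, rfl⟩ := (mem_orbitFin' N).mp hy
  rw [smul_smul, ← pow_succ']
  exact T_pow_smul_mem_orbitFin N b (i + 1)

/-- The cusp sums are invariant under `ρ(T)`. [folklore] -/
theorem cuspSumK_permRep_T (f : Gamma0Coset N → K) :
    cuspSumK K N (permRep K N T f) = cuspSumK K N f := by
  funext b
  simp only [cuspSumK_apply, permRep_apply]
  exact Finset.sum_nbij' (fun y ↦ T⁻¹ • y) (fun y ↦ T • y) (fun y hy ↦ T_inv_smul_mem_orbitFin hy)
    (fun y hy ↦ T_smul_mem_orbitFin hy) (fun y _ ↦ smul_inv_smul T y)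
    (fun y _ ↦ inv_smul_smul T y) (fun y _ ↦ rfl)

/-- The cusp sums kill coboundaries. [folklore] -/
theorem cuspSumK_cobd (f : Gamma0Coset N → K) : cuspSumK K N ((cobd (permRep K N) f).1 T) = 0 := by
  rw [cobd_apply, map_sub, cuspSumK_permRep_T, sub_self]

/-- **The cusp sums kill the lift of a parabolic cocycle**: over the orbit of a base point `b` of
width `w`, `∑ F_u(T) = F_u(T^w)(T^{w-1}b) = u(s⁻¹ T^w s) = 0`. [cite: ShimuraIATAF1971, §8.1 (8.1.4)] -/
theorem cuspSumK_liftL (u : parabolicHoms K N) : cuspSumK K N (liftL (u : Gamma0 N → K) T) = 0 := by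
  obtain ⟨hu, hpar⟩ := mem_parabolicHoms_iff.mp u.2
  funext b
  obtain ⟨b, hb⟩ := b
  rw [cuspSumK_apply, Pi.zero_apply, sum_orbitFin_eq]
  set w := width N b with hw
  have hx : T ^ w • (T ^ (w - 1) • b) = T ^ (w - 1) • b := by
    rw [smul_smul, ← pow_add, add_comm, pow_add, mul_smul, T_pow_width_smul]
  -- `F_u(T^w)(T^{w-1} b) = ∑_{i<w} F_u(T)(T^{-i} T^{w-1} b) = ∑_{j<w} F_u(T)(T^j b)`
  have hsum := apply_pow_of_isCrossedHom (isCrossedHom_liftL hu) T w (T ^ (w - 1) • b)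
  have hreindex : ∑ i ∈ Finset.range w, liftL (u : Gamma0 N → K) T ((T ^ i)⁻¹ • T ^ (w - 1) • b) =
      ∑ i ∈ Finset.range w, liftL (u : Gamma0 N → K) T (T ^ i • b) := by
    rw [← Finset.sum_range_reflect]
    refine Finset.sum_congr rfl fun i hi ↦ ?_
    have hi' : i < w := Finset.mem_range.mp hi
    congr 1
    rw [inv_smul_eq_iff, smul_smul, ← pow_add, Nat.sub_add_cancel (by omega : i ≤ w - 1)]
  rw [← hreindex, ← hsum, liftL_apply]
  apply hpar
  rw [coe_lam, inv_smul_eq_iff.mpr hx.symm]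
  exact ParabolicCount.isParabolic_conj (ParabolicCount.isParabolic_T_pow (width_pos N b).ne') _

/-- The cusp-sum map is onto: the function supported on the base points with values `v` has cusp
sums `v`. [folklore] -/
theorem cuspSumK_single (v : {x // x ∈ basePoints N} → K) :
    cuspSumK K N (fun x ↦ if hx : x ∈ basePoints N then v ⟨x, hx⟩ else 0) = v := by
  funext p
  obtain ⟨p, hp⟩ := p
  rw [cuspSumK_apply, Finset.sum_eq_single p]
  · simp [hp]
  · intro y hy hyp
    rw [dif_neg]
    intro hyb
    have h1 : base N y = base N p := base_eq_of_mem N hy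
    rw [(Finset.mem_filter.mp hyb).2, (Finset.mem_filter.mp hp).2] at h1
    exact hyp h1
  · intro hnp
    exact absurd (self_mem_orbitFin N p) hnp

/-- The total of the cusp sums is the total sum. [folklore] -/
theorem sum_cuspSumK (f : Gamma0Coset N → K) : ∑ b, cuspSumK K N f b = ∑ x, f x :=
  calc ∑ b, cuspSumK K N f b
      = ∑ b : {x // x ∈ basePoints N}, ∑ x ∈ Finset.univ.filter (fun x ↦ base N x = b.1), f x :=
        Finset.sum_congr rfl fun b _ ↦ by
          rw [cuspSumK_apply, filter_base_eq b.1 (Finset.mem_filter.mp b.2).2]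
    _ = ∑ b ∈ basePoints N, ∑ x ∈ Finset.univ.filter (fun x ↦ base N x = b), f x :=
        Finset.sum_coe_sort (basePoints N) (fun b ↦ ∑ x ∈ Finset.univ.filter (fun x ↦ base N x = b), f x)
    _ = ∑ x, f x := Finset.sum_fiberwise_of_maps_to (fun x _ ↦ base_mem_basePoints x) f

/-! #### The count -/

variable (K N) in
/-- The **cusp map** `Z¹(SL(2, ℤ), K^X) → K^{cusps}`, `F ↦` cusp sums of `F(T)`. [folklore] -/
def cuspMap : crossedHoms (permRep K N) →ₗ[K] ({x // x ∈ basePoints N} → K) :=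
  (cuspSumK K N) ∘ₗ ((LinearMap.proj T).comp (Submodule.subtype _))

/-- Unfolding `cuspMap`. [folklore] -/
@[simp] theorem cuspMap_apply (F : crossedHoms (permRep K N)) : cuspMap K N F = cuspSumK K N (F.1 T) :=
  rfl

/-- The lift lands in the kernel of the cusp map. [folklore] -/
theorem range_liftHom_le_ker : LinearMap.range (liftHom K N) ≤ LinearMap.ker (cuspMap K N) := by
  rintro _ ⟨u, rfl⟩
  rw [LinearMap.mem_ker, cuspMap_apply]
  exact cuspSumK_liftL u

/-- The coboundaries lie in the kernel of the cusp map. [folklore] -/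
theorem range_cobd_le_ker : LinearMap.range (cobd (permRep K N)) ≤ LinearMap.ker (cuspMap K N) := by
  rintro _ ⟨f, rfl⟩
  rw [LinearMap.mem_ker, cuspMap_apply]
  exact cuspSumK_cobd f

variable (K N) in
/-- The total sum on `K^{cusps}`. [folklore] -/
def sumB : ({x // x ∈ basePoints N} → K) →ₗ[K] K where
  toFun v := ∑ b, v b
  map_add' v w := by simp [Finset.sum_add_distrib]
  map_smul' c v := by simp [Finset.mul_sum]

/-- Unfolding `sumB`. [folklore] -/
@[simp] theorem sumB_apply (v : {x // x ∈ basePoints N} → K) : sumB K N v = ∑ b, v b := rfl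

/-- **The cusp map takes every value with total sum `0`**: for `∑_b v_b = 0` there is a crossed
homomorphism `F` with cusp sums `v` — `F(T) = ρ(S)⁻¹(w_U - w_S)` can be any element of
`(ρS - 1)W + (ρU - 1)W ⊇ ker Σ`, by the existence half of `PSL₂(ℤ) = ℤ/2 ∗ ℤ/3`.
[cite: SerreTrees1980, I.4.2 Thm. 7, II.1.4] [cite: Brown1982, VII.9] -/
theorem ker_sumB_le_range_cuspMap : LinearMap.ker (sumB K N) ≤ LinearMap.range (cuspMap K N) := by
  intro v hv
  rw [LinearMap.mem_ker, sumB_apply] at hv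
  -- a function with cusp sums `v` and total sum `0`
  set f : Gamma0Coset N → K := fun x ↦ if hx : x ∈ basePoints N then v ⟨x, hx⟩ else 0 with hf_def
  have hfv : cuspSumK K N f = v := cuspSumK_single v
  have hfaug : aug K N f = 0 := by
    rw [aug_apply, ← sum_cuspSumK, hfv, hv]
  -- `ρ(S) f ∈ ker Σ ⊆ (ρS - 1)W + (ρU - 1)W`
  have hSf : permRep K N S f ∈ relSum K N := by
    apply ker_aug_le_relSum
    rw [LinearMap.mem_ker, aug_permRep, hfaug]
  obtain ⟨wS', hwS', wU, hwU, hsum⟩ := Submodule.mem_sup.mp hSf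
  obtain ⟨a, rfl⟩ := hwS'
  obtain ⟨c, rfl⟩ := hwU
  have hρ : permRep K N (-1) = 1 := permRep_neg_one
  have hS2 : permRep K N S * permRep K N S = 1 := by
    rw [← map_mul, ← sq, show S ^ 2 = (-1 : SL(2, ℤ)) by decide, hρ]
  have hU3 : permRep K N U * permRep K N U * permRep K N U = 1 := by
    rw [← map_mul, ← map_mul, ← pow_three', U_pow_three, hρ]
  -- the data for the existence theorem
  set wS : Gamma0Coset N → K := -((permRep K N S - 1) a) with hwS_def
  have hwS : wS + permRep K N S wS = 0 := by
    have e2 : permRep K N S (permRep K N S a) = a := by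
      rw [← Module.End.mul_apply, hS2, Module.End.one_apply]
    simp only [hwS_def, LinearMap.sub_apply, Module.End.one_apply, map_neg, map_sub, e2]
    abel
  have hwU : (permRep K N U - 1) c + permRep K N U ((permRep K N U - 1) c) +
      permRep K N U (permRep K N U ((permRep K N U - 1) c)) = 0 := by
    have e3 : permRep K N U (permRep K N U (permRep K N U c)) = c := by
      rw [← Module.End.mul_apply, ← Module.End.mul_apply, hU3, Module.End.one_apply]
    simp only [LinearMap.sub_apply, Module.End.one_apply, map_sub, e3]
    abel
  obtain ⟨F, hF, hFS, hFU⟩ := exists_isCrossedHom hρ hwS hwU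
  refine ⟨⟨F, hF⟩, ?_⟩
  rw [cuspMap_apply]
  change cuspSumK K N (F T) = v
  have hT : F T = f := by
    have h1 : F T = F S⁻¹ + permRep K N S⁻¹ (F U) := by rw [T_eq, hF]
    rw [h1, hF.map_inv, hFS, hFU, hwS_def, map_neg, neg_neg, ← map_add, hsum,
      ← Module.End.mul_apply, ← map_mul, inv_mul_cancel, map_one, Module.End.one_apply]
  rw [hT, hfv]

/-- **`dim_K H¹_P(Γ₀(N), K) ≤ 2 dim_ℂ S₂(Γ₀(N))`** for every field `K` with `2 ≠ 0`, `3 ≠ 0` and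
every `N ≥ 1` (Shimura's (8.2.24) for `n = 0`, `Γ = Γ₀(N)`, in every admissible characteristic).
[cite: ShimuraIATAF1971, §8.2 (8.2.23)–(8.2.24)] [cite: SerreTrees1980, II.2.8] -/
theorem finrank_parabolicHoms_le (h2 : (2 : K) ≠ 0) (h3 : (3 : K) ≠ 0) :
    Module.finrank K (parabolicHoms K N) ≤ 2 * Module.finrank ℂ (CuspForm (Gamma0 N) 2) := by
  -- numerical inputs (as in `ParabolicCount.six_mul_finrank_parabolicCocycles_le`)
  have hμ : (Gamma0 N).index = Fintype.card (Gamma0Coset N) := by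
    rw [Subgroup.index, Nat.card_eq_fintype_card]
  have hε₂ : Nat.card {q : SL(2, ℤ) ⧸ Gamma0 N // S • q = q} =
      (Finset.univ.filter fun q : Gamma0Coset N ↦ S • q = q).card := by
    rw [Nat.card_eq_fintype_card, Fintype.card_subtype]
  have hε₃ : Nat.card {q : SL(2, ℤ) ⧸ Gamma0 N // (T * S) • q = q} =
      (Finset.univ.filter fun q : Gamma0Coset N ↦ (S * T) • q = q).card := by
    rw [card_fixed_TS_eq_card_fixed_ST, Nat.card_eq_fintype_card, Fintype.card_subtype]
  have hε : Nat.card (CuspOrbits (Gamma0 N : Subgroup (GL (Fin 2) ℝ))) = (basePoints N).card := by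
    rw [card_basePoints, ← numCusps_eq_nuInfty_holds N, numCusps]
  have hgenus := twelve_mul_finrank_cuspForm_two_gamma0_holds N (Gamma0_is_congruence N)
  rw [adjoinNegI_gamma0, ellipticPointCount_two_gamma0_eq_card, ellipticPointCount_three_gamma0_eq_card,
    hμ, hε₂, hε₃, hε] at hgenus
  -- dimensions of `Z¹` and `B¹`
  have hρ : permRep K N (-1) = 1 := permRep_neg_one
  have hZ := finrank_crossedHoms_add (permRep K N) hρ h2 h3
  have hB := finrank_range_cobd_add (permRep K N)
  rw [← fixedFun_eq_ker, ← fixedFun_eq_ker] at hZ hB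
  rw [finrank_fixedFun_S_inf_U] at hB
  rw [Module.finrank_fintype_fun_eq_card] at hZ hB
  have hS := two_mul_finrank_fixedFun_S (K := K) (N := N)
  have hU := three_mul_finrank_fixedFun_U (K := K) (N := N)
  -- the Shapiro lift and the coboundaries inside `ker(cuspMap)`
  have hL : Module.finrank K (LinearMap.range (liftHom K N)) = Module.finrank K (parabolicHoms K N) :=
    LinearMap.finrank_range_of_inj liftHom_injective
  have hsup := Submodule.finrank_sup_add_finrank_inf_eq (LinearMap.range (liftHom K N))
    (LinearMap.range (cobd (permRep K N)))
  rw [range_liftHom_inf_range_cobd, finrank_bot, add_zero] at hsup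
  have hle : Module.finrank K ↥(LinearMap.range (liftHom K N) ⊔ LinearMap.range (cobd (permRep K N))) ≤
      Module.finrank K (LinearMap.ker (cuspMap K N)) :=
    Submodule.finrank_mono (sup_le range_liftHom_le_ker range_cobd_le_ker)
  -- rank–nullity for the cusp map and for the total sum
  have hC := LinearMap.finrank_range_add_finrank_ker (cuspMap K N)
  have hsB := LinearMap.finrank_range_add_finrank_ker (sumB K N)
  rw [Module.finrank_fintype_fun_eq_card, Fintype.card_coe] at hsB
  have hsB1 : Module.finrank K (LinearMap.range (sumB K N)) ≤ 1 :=
    (Submodule.finrank_le _).trans (Module.finrank_self K).le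
  have hker := Submodule.finrank_mono (ker_sumB_le_range_cuspMap (K := K) (N := N))
  omega

end Finite

end ParabolicCountK

end Literature.NumberTheory.ModularForms
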